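import Literature.AlgebraicGeometry.HodgeTheory.HypersurfaceResidueFormNonzero
import HarnessLib

/-!
# The fixed-index residue formula of a hypersurface: local holomorphy, non-vanishing, transition

Family `hodge`, layer `Literature/AlgebraicGeometry/HodgeTheory`. PROOF FILE (theorems only; no
definition, no named fact — D-0026), companion of `HypersurfaceResidueFormDef`,
`HypersurfaceResidueFormHolomorphic` and `HypersurfaceResidueFormNonzero`. For a map
`ψ : M → ℙ ℂ ℂ^{m+2}` with holomorphic affine coordinates on a complex manifold `M` charted on `E`,
those files build the GLOBAL residue form `residueForm ψ F P = ψ^* Res_Y(PΩ/F)` out of the local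
formula `residueFormula ψ F P i j x = P(Z̃ᵢ x) · det(N_j, Z̃ᵢ x, dZ̃ᵢ(x) ·)` (Voisin II, §6.1.1,
§6.1.3), which requires `P` homogeneous of degree `d − m − 2 ≥ 0`. This file records the
properties of the local formula itself, for ANY degree `d` of `F` (so also for `d < m + 2`, where
`Ω/F` has no global residue but `det(N, Z̃ᵢ, dZ̃ᵢ ·)` is still the nowhere-vanishing holomorphic
`m`-form `± dx_K/(∂f/∂x_j)` of the affine piece `Y ∩ Uᵢ`):

* `exists_analyticGerm_residueFormula` — **holomorphy**: at every `x₀ ∈ Mᵢ = ψ⁻¹(Uᵢ)` with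
  `∂_jF(Z̃ᵢ x₀) ≠ 0` the `m`-form `x ↦ residueFormula ψ F P i j x` is, in the chart at `x₀`, the
  germ of a complex-analytic function (the computation of `isHolomorphicInCharts_residueForm`
  with the indices frozen; no homogeneity is used);
* `residueFormula_one_ne_zero` — **non-vanishing** of `residueFormula ψ F 1 i j x` at every such
  point when `ψ` is an embedding into `{F = 0}` with the Jacobian condition and `dim E = m`
  (the computation of `residueForm_ne_zero`: injectivity of `dZ̃ᵢ(x)`, `injective_liftDeriv`);
  `apply_ne_zero_of_ne_zero` — hence non-zero on every complex basis of `E`;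
* `residueFormula_one_eq_zpow_smul` — **transition between the charts `Uᵢ`, `U_{i'}`**:
  `residueFormula ψ F 1 i' j x = (Z̃ᵢ x)_{i'}^{d−(m+2)} • residueFormula ψ F 1 i j x` (an INTEGER
  power; the computation of `residueFormula_eq_of_idx` without the compensating weight `P`): in
  print `Res_{U_{i'}}(Ω/F) = (x_{i'}/x_i)^{d−m−2} Res_{U_i}(Ω/F)`, the cocycle of `K_Y = 𝒪_Y(d−m−2)`
  (adjunction, Hartshorne II 8.20.3).

Consumer: the holomorphic `2`-forms of the Fermat surface (`FermatSurfaceEigenformsOnModels`).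

## References

* [VoisinHodgeII2003] C. Voisin, Hodge Theory and Complex Algebraic Geometry II (2003), §6.1.1,
  §6.1.3.
* [Hartshorne1977] R. Hartshorne, Algebraic Geometry (1977), II Example 8.20.3 (adjunction for
  hypersurfaces).
-/

noncomputable section

open scoped Manifold ContDiff Topology LinearAlgebra.Projectivization
open Set Filter Projectivization

namespace Literature.AlgebraicGeometry.HodgeTheory

open Literature.NumberTheory.Transcendental Literature.Geometry.Kaehler

/-! ### A non-zero top-degree `ℂ`-alternating form is non-zero on every basis -/

section TopForm

variable {E : Type*} [AddCommGroup E] [Module ℂ E] [TopologicalSpace E] {n : ℕ}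

/-- A non-zero continuous `ℂ`-alternating `n`-form on an `n`-dimensional space does not vanish on
any basis (`AlternatingMap.eq_smul_basis_det`: `a = a(b) det_b`). [folklore] -/
theorem apply_ne_zero_of_ne_zero (a : E [⋀^Fin n]→L[ℂ] ℂ) (b : Module.Basis (Fin n) ℂ E)
    (ha : a ≠ 0) : a b ≠ 0 := by
  intro h0
  apply ha
  have key := a.toAlternatingMap.eq_smul_basis_det b
  ext v
  have := congrArg (fun f : E [⋀^Fin n]→ₗ[ℂ] ℂ ↦ f v) key
  simp only [AlternatingMap.smul_apply, smul_eq_mul] at this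
  change a v = 0
  change a v = a b * b.det v at this
  rw [this, h0, zero_mul]

end TopForm

section Main

variable {m : ℕ} {E : Type*} [NormedAddCommGroup E] [NormedSpace ℂ E] [FiniteDimensional ℂ E]
  {M : Type*} [TopologicalSpace M] [ChartedSpace E M] [IsManifold 𝓘(ℂ, E) ω M]
  (ψ : M → ℙ ℂ (Fin (m + 2) → ℂ)) {F : MvPolynomial (Fin (m + 2)) ℂ} {d : ℕ}

/-! ### Holomorphy of the fixed-index formula -/

/-- **The fixed-index residue formula is holomorphic in charts.** For `ψ` continuous with
holomorphic affine coordinates, any `P`, a chart index `i` with `x₀ ∈ Mᵢ` and a normal index `j`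
with `∂_jF(Z̃ᵢ x₀) ≠ 0`, an `m`-form `η₀` given by `x ↦ residueFormula ψ F P i j x` (real
scalars restricted) has, in the chart at `x₀`, the complex-analytic representative
`y ↦ P(Z y) · det(N_j(Z y), Z y, DZ(y) ·)`, `Z = Z̃ᵢ ∘ chart_{x₀}⁻¹` (`analyticAt_projLift_comp_symm`,
`liftDeriv_comp_tangentCoordChange`, `contDiffAt_coneResidue`). No homogeneity of `F` or `P` is
needed. [cite: VoisinHodgeII2003, §6.1.1 and §6.1.3] -/
theorem exists_analyticGerm_residueFormula [IsManifold 𝓘(ℝ, E) ∞ M] (hψ : Continuous ψ)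
    (hhol : HasHolomorphicCoords E ψ) (P : MvPolynomial (Fin (m + 2)) ℂ) {i j : Fin (m + 2)}
    {x₀ : M} (hi : x₀ ∈ liftDomain ψ i)
    (hj : MvPolynomial.eval (projLift ψ i x₀) (MvPolynomial.pderiv j F) ≠ 0)
    {η₀ : MForm 𝓘(ℝ, E) M ℂ m}
    (hη₀ : ∀ x, η₀ x = (show E [⋀^Fin m]→L[ℝ] ℂ from (residueFormula ψ F P i j x).restrictScalars ℝ)) :
    ∃ g : E → E [⋀^Fin m]→L[ℂ] ℂ, AnalyticAt ℂ g (extChartAt 𝓘(ℝ, E) x₀ x₀) ∧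
      η₀.inChart x₀ =ᶠ[𝓝 (extChartAt 𝓘(ℝ, E) x₀ x₀)] fun y ↦ (g y).restrictScalars ℝ := by
  set Zc : E → Fin (m + 2) → ℂ := projLift ψ i ∘ (extChartAt 𝓘(ℂ, E) x₀).symm with hZc
  set g : E → E [⋀^Fin m]→L[ℂ] ℂ := fun y ↦ MvPolynomial.eval (Zc y) P •
    coneResidue (normalVec F (Zc y) j) (Zc y) (fderiv ℂ Zc y) with hg
  have hc₀ : extChartAt 𝓘(ℝ, E) x₀ x₀ = extChartAt 𝓘(ℂ, E) x₀ x₀ := rfl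
  have hZc₀ : Zc (extChartAt 𝓘(ℂ, E) x₀ x₀) = projLift ψ i x₀ := by simp [hZc]
  refine ⟨g, ?_, ?_⟩
  · -- analyticity of the representative
    rw [hc₀]
    have hZ : AnalyticAt ℂ Zc (extChartAt 𝓘(ℂ, E) x₀ x₀) :=
      analyticAt_projLift_comp_symm ψ hψ hhol i x₀ (mem_extChartAt_target x₀) (by simpa using hi)
    have hL : AnalyticAt ℂ (fderiv ℂ Zc) (extChartAt 𝓘(ℂ, E) x₀ x₀) := hZ.fderiv
    have hPz : AnalyticAt ℂ (fun y ↦ MvPolynomial.eval (Zc y) P) (extChartAt 𝓘(ℂ, E) x₀ x₀) :=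
      (AnalyticOnNhd.eval_mvPolynomial P _ (mem_univ _)).comp hZ
    have hN : AnalyticAt ℂ (fun y ↦ normalVec F (Zc y) j) (extChartAt 𝓘(ℂ, E) x₀ x₀) := by
      have h1 : AnalyticAt ℂ (fun y ↦ MvPolynomial.eval (Zc y) (MvPolynomial.pderiv j F))
          (extChartAt 𝓘(ℂ, E) x₀ x₀) :=
        (AnalyticOnNhd.eval_mvPolynomial (MvPolynomial.pderiv j F) _ (mem_univ _)).comp hZ
      have h2 := h1.inv (by rw [hZc₀]; exact hj)
      exact h2.smul analyticAt_const
    have := hPz.contDiffAt.smul (contDiffAt_coneResidue (n := ω) hN.contDiffAt hZ.contDiffAt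
      hL.contDiffAt)
    exact this.analyticAt
  · -- the formula for the chart representative
    rw [hc₀]
    have htarget : ∀ᶠ y in 𝓝 (extChartAt 𝓘(ℂ, E) x₀ x₀), y ∈ (extChartAt 𝓘(ℂ, E) x₀).target :=
      extChartAt_target_mem_nhds x₀
    have hsymm : ContinuousAt (extChartAt 𝓘(ℂ, E) x₀).symm (extChartAt 𝓘(ℂ, E) x₀ x₀) :=
      continuousAt_extChartAt_symm x₀
    have hdom₀ : ∀ᶠ x in 𝓝 ((extChartAt 𝓘(ℂ, E) x₀).symm (extChartAt 𝓘(ℂ, E) x₀ x₀)),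
        x ∈ liftDomain ψ i := by
      rw [extChartAt_to_inv]; exact (isOpen_liftDomain ψ hψ i).mem_nhds hi
    have hdom := hsymm.tendsto.eventually hdom₀
    filter_upwards [htarget, hdom] with y hy hyi
    set x := (extChartAt 𝓘(ℂ, E) x₀).symm y with hx
    have hxs : x ∈ (chartAt E x₀).source := by
      have h' : x ∈ (extChartAt 𝓘(ℂ, E) x₀).source := (extChartAt 𝓘(ℂ, E) x₀).map_target hy
      rwa [extChartAt_source] at h'
    rw [MForm.inChart_eq_of_mem_target _ hy, hη₀]
    change (((residueFormula ψ F P i j x).restrictScalars ℝ).compContinuousLinearMap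
      (tangentCoordChange 𝓘(ℝ, E) x₀ x x) : E [⋀^Fin m]→L[ℝ] ℂ) = (g y).restrictScalars ℝ
    rw [Literature.Geometry.Kaehler.tangentCoordChange_eq_restrictScalars
      (by simp only [extChartAt_source]; exact ⟨hxs, mem_chart_source E x⟩)]
    rw [← restrictScalars_compContinuousLinearMap]
    congr 1
    rw [residueFormula, smul_compContinuousLinearMap, ← coneResidue_comp,
      liftDeriv_comp_tangentCoordChange ψ hψ hhol i x₀ hy hyi]
    rfl

/-! ### Non-vanishing of the fixed-index formula with `P = 1` -/

/-- **Non-vanishing of `det(N_j, Z̃ᵢ x, dZ̃ᵢ(x) ·)`.** Let `F` be homogeneous (any degree `d`) with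
non-vanishing gradient at the non-zero zeros of `F`, `ψ` a topological embedding into the
projective zero locus of `F` with holomorphic affine coordinates, `dim_ℂ E = m`. Then for
`x ∈ Mᵢ` and any admissible normal index `j` (`∂_jF(Z̃ᵢ x) ≠ 0`) the form
`residueFormula ψ F 1 i j x` is non-zero (`linearIndependent_coneRows` with `ℓ = dF(Z̃ᵢ x)` and
the injectivity of `(v, c) ↦ dZ̃ᵢ(x) v + c Z̃ᵢ x`, from `injective_liftDeriv`). In print:
`± dx_K/(∂f/∂x_j)` vanishes nowhere on `Y ∩ Uᵢ`. [cite: VoisinHodgeII2003, §6.1.3] -/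
theorem residueFormula_one_ne_zero (hF : F.IsHomogeneous d) (hψ : Topology.IsEmbedding ψ)
    (hrange : Set.range ψ ⊆ projZeroLocus {F})
    (hjac : ∀ z : Fin (m + 2) → ℂ, z ≠ 0 → MvPolynomial.eval z F = 0 →
      ∃ j, MvPolynomial.eval z (MvPolynomial.pderiv j F) ≠ 0)
    (hhol : HasHolomorphicCoords E ψ) (hdim : Module.finrank ℂ E = m)
    {i₀ j : Fin (m + 2)} {x : M} (hx : x ∈ liftDomain ψ i₀)
    (hj : MvPolynomial.eval (projLift ψ i₀ x) (MvPolynomial.pderiv j F) ≠ 0) :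
    residueFormula (E := E) ψ F 1 i₀ j x ≠ 0 := by
  have hψc : Continuous ψ := hψ.continuous
  set z := projLift ψ i₀ x with hzdef
  have hz0 : MvPolynomial.eval z F = 0 := eval_projLift_eq_zero ψ hF hrange hx
  have hzi : z i₀ = 1 := projLift_apply_self ψ i₀ x
  set L := liftDeriv (E := E) ψ i₀ x with hLdef
  set N := normalVec F z j with hNdef
  set b := Module.finBasisOfFinrankEq ℂ E hdim with hbdef
  have hℓN : polyGrad F z N ≠ 0 := by rw [hNdef, polyGrad_normalVec hj]; exact one_ne_zero
  have hℓz : polyGrad F z z = 0 := by rw [polyGrad_apply_self hF, hz0, mul_zero]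
  have hℓL : ∀ w, polyGrad F z (L w) = 0 := fun w ↦ by
    have := polyGrad_comp_mfderiv_projLift ψ hF hψc hrange hhol hx
    exact DFunLike.congr_fun this w
  obtain ⟨hLJ, -⟩ := liftDeriv_eq_finInsertCLM_comp ψ hψc hhol hx
  have hLinj := injective_liftDeriv ψ hF hψ hrange hjac hhol hdim hx
  have hinj : ∀ (w : E) (c : ℂ), w ∈ Submodule.span ℂ (Set.range b) → L w + c • z = 0 →
      w = 0 ∧ c = 0 := by
    intro w c _ h
    have hi₀ : (L w) i₀ = 0 := by
      rw [hLdef, hLJ]; simp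
    have hc : c = 0 := by
      have := congrFun h i₀
      rw [Pi.add_apply, Pi.smul_apply, hi₀, hzi, smul_eq_mul, mul_one, zero_add] at this
      exact this
    refine ⟨hLinj ?_, hc⟩
    rw [hc, zero_smul, add_zero] at h
    rw [h, map_zero]
  have hli := linearIndependent_coneRows N z L b (polyGrad F z : (Fin (m + 2) → ℂ) →ₗ[ℂ] ℂ)
    hℓN hℓz hℓL b.linearIndependent hinj
  have hne := coneResidue_apply_ne_zero_of_linearIndependent N z L b hli
  intro h0
  apply hne
  have h2 := congrArg (fun (A : E [⋀^Fin m]→L[ℂ] ℂ) ↦ A (fun l ↦ b l)) h0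
  simp only [ContinuousAlternatingMap.coe_zero, Pi.zero_apply] at h2
  rw [residueFormula, ContinuousAlternatingMap.smul_apply, ← hzdef, map_one, one_smul] at h2
  exact h2

/-! ### Transition between two charts -/

omit [FiniteDimensional ℂ E] [IsManifold 𝓘(ℂ, E) ω M] in
/-- **Change of chart index for `det(N_j, Z̃, dZ̃ ·)`**: on `Mᵢ ∩ M_{i'}`,
`residueFormula ψ F 1 i' j x = (Z̃ᵢ x)_{i'}^{d − (m+2)} • residueFormula ψ F 1 i j x` (integer
exponent). With `Z̃_{i'} = c • Z̃ᵢ`, `c = (Z̃ᵢ x)_{i'}⁻¹` near `x`, the product rule gives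
`dZ̃_{i'} = c dZ̃ᵢ + dc ⊗ Z̃ᵢ`, and `det((c^{d-1})⁻¹ N, c z, (c L + φ ⊗ z) ·) = (c^{d-1})⁻¹ c c^m det(N, z, L ·)`
(`normalVec_smul`, `coneResidue_smul_left/mid`, `coneResidue_lift_change`). In print this is the
cocycle `(x_{i'}/x_i)^{d−m−2}` of `K_Y ≅ 𝒪_Y(d − m − 2)` relating the local generators
`Res_{Uᵢ}(Ω/F)`. [cite: VoisinHodgeII2003, §6.1.3] [cite: Hartshorne1977, II Example 8.20.3] -/
theorem residueFormula_one_eq_zpow_smul (hF : F.IsHomogeneous d) (hd : 1 ≤ d) (hψ : Continuous ψ)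
    (hhol : HasHolomorphicCoords E ψ) {i i' j : Fin (m + 2)} {x : M} (hi : x ∈ liftDomain ψ i)
    (hi' : x ∈ liftDomain ψ i') :
    residueFormula (E := E) ψ F 1 i' j x =
      (projLift ψ i x i') ^ ((d : ℤ) - (m + 2 : ℕ)) • residueFormula ψ F 1 i j x := by
  set z := projLift ψ i x with hz
  set c : ℂ := (z i')⁻¹ with hc
  have hzi' : z i' ≠ 0 := by
    intro h0
    have := projLift_eq_smul_of_mem ψ hi hi'
    rw [← hz, h0, inv_zero, zero_smul] at this
    exact projLift_ne_zero ψ i' x this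
  have hc0 : c ≠ 0 := inv_ne_zero hzi'
  have hz' : projLift ψ i' x = c • z := projLift_eq_smul_of_mem ψ hi hi'
  -- the lifts are proportional near `x`
  set a : M → ℂ := fun y ↦ (projLift ψ i y i')⁻¹ with ha
  have hopen : IsOpen (liftDomain ψ i ∩ liftDomain ψ i') :=
    (isOpen_liftDomain ψ hψ i).inter (isOpen_liftDomain ψ hψ i')
  have hev : projLift ψ i' =ᶠ[𝓝 x] fun y ↦ a y • projLift ψ i y := by
    filter_upwards [hopen.mem_nhds ⟨hi, hi'⟩] with y hy
    exact projLift_eq_smul_of_mem ψ hy.1 hy.2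
  have hgi : MDifferentiableAt 𝓘(ℂ, E) 𝓘(ℂ, Fin (m + 2) → ℂ) (projLift ψ i) x :=
    (mdifferentiableOn_projLift ψ hhol i x hi).mdifferentiableAt ((isOpen_liftDomain ψ hψ i).mem_nhds hi)
  have hcoord : MDifferentiableAt 𝓘(ℂ, E) 𝓘(ℂ, ℂ) (fun y ↦ projLift ψ i y i') x :=
    mdifferentiableWithinAt_univ.mp
      ((Literature.Geometry.Kaehler.mdifferentiableWithinAt_pi_space (s := univ)).mp
        hgi.mdifferentiableWithinAt i')
  have ha' : MDifferentiableAt 𝓘(ℂ, E) 𝓘(ℂ, ℂ) a x :=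
    (hcoord.hasMFDerivAt.inv hzi').mdifferentiableAt
  have hL := liftDeriv_eq_of_smul ψ hev ha' hgi
  have hax : a x = c := rfl
  rw [residueFormula, residueFormula, hL, hax, hz', ← hz, normalVec_smul hF, map_one, map_one,
    one_smul, one_smul, coneResidue_smul_left, coneResidue_smul_mid, coneResidue_lift_change]
  simp only [smul_smul]
  congr 1
  -- the scalar: `(c^{d-1})⁻¹ * (c * c^m) = (z i')^(d - (m+2))`
  rw [hc, ← pow_succ', inv_pow, inv_pow, inv_inv, ← zpow_natCast, ← zpow_natCast, ← zpow_neg,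
    ← zpow_add₀ hzi']
  congr 1
  push_cast
  omega

end Main

end Literature.AlgebraicGeometry.HodgeTheory

end
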